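import Summits.QuantumFields.YangMills.Theses.LangevinControlUV
import Summits.QuantumFields.YangMills.Cruxes.OSLegsFromFemtoAndGap.Disproof
import Summits.QuantumFields.YangMills.Theorems.OSLegsFromFemtoAndGap.Negative.UnitsAndGapFree
import Summits.QuantumFields.YangMills.Theorems.OSLegsFromFemtoAndGap.Negative.ForallSchemeFalse
import Summits.QuantumFields.YangMills.Theorems.OSLegsFromFemtoAndGap.Negative.GapClauseMonotone

/-!
# Disproof of `OSLegsAtWeakCouplingC` — standing adversary work file (cdisprove, gen 1 cycle 1)

Crux item `stmt-QuantumFields-16207` =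
`Summit.QuantumFields.YangMills.Theses.LangevinControlUV.OSLegsAtWeakCouplingC` (route
`LangevinControlUV`, rank 6): for every compact simple `G`, faithful unitary `r` and CONTINUOUS
unit map `a : ℝ → ℝ`, the femto two-point package (H1 = `TwoPoint`), the femto skewness witness
(H2 = `Skewness`) and the lattice gap in units `a` (H3 = `GapInUnits`) imply `ConclC`: a scheme
`sch` in units `a` (`sch.a k = a (sch.β k)`) with `sch.HasWeakCouplingLimit` (`β_k → +∞`) and OS
data `T` with `IsYangMillsFor r sch T`, `T.IsNontrivial r.curvature`, `T.IsNonGaussian r.curvature`,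
`HasLatticeMassGap r sch Δ`, `Δ > 0`. It is the predecessor crux `OSLegsFromFemtoAndGap`
(stmt-9367; standing file `Cruxes/OSLegsFromFemtoAndGap/Disproof.lean`, whose §0 predicates
`TwoPoint / Skewness / GapInUnits / Concl` and §2–§9 lemmas are IMPORTED and cited below) with the
token `Continuous a →` inserted and the conjunct `sch.HasWeakCouplingLimit ∧` added.

VERDICT (cycle 1): **RESISTS** — no refutation, no misstatement. Everything below the docblock is
checked; `sorry` appears only in the `NearMiss` section (§8), by design.

## Findings (this crux; what is inherited is said so)

* §0 `cruxC_iff` — uncurried: `∀ G r a, Continuous a → TwoPoint → Skewness → GapInUnits → ConclC`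
  (definitional); `conclC_imp_concl` (the new conclusion implies the old), `cruxC_of_crux16110`
  (`OSLegsAtWeakCoupling → OSLegsAtWeakCouplingC`, one line).
* §1 THE WALL, inherited verbatim and NOT softened by continuity (`hypothesesWitness_of_not_cruxC`):
  a proof of `¬ OSLegsAtWeakCouplingC` exhibits a genuine compact simple Lie group `G` (connected,
  non-abelian, linear — `IsSimpleCompactGroup ∧ Nonempty LatticeRep`, no junk inhabitant), a
  faithful `r` and a continuous `a` meeting H1 ∧ H2 ∧ H3; its H3 component is, at every FIXED
  `β ≥ β₂`, volume-uniform exponential clustering of all gauge-invariant pairs in the lattice time —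
  the lattice mass gap of 4D `G`-gauge theory at arbitrarily weak coupling (tree conjecture
  `LatticeMassGapAllCouplings`; Chatterjee arXiv:1803.01950 Pb 5.1). `Continuous a` only shrinks the
  disprover's freedom (every continuous map was already admissible in 9367/16110). Hence: no
  unconditional `¬`, and no honest `--negative-modulo H` either (the `H` would contain the positive
  infrared problem; see predecessor §8 [D]).
* §2 CHEAP LOAD-BEARING (proved, unconditional via `SU(2)`; LANDED as
  `Theorems/OSLegsAtWeakCouplingC/Negative/FalseWithoutTwoPoint.lean` — p123141 ACCEPTED, commit 0ce272d230a1):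
  `cruxC_false_without_twoPoint`
  — with H1 dropped the C-statement is FALSE: `a ≡ 0` IS continuous, meets H2 (`Γ₃ = id`) and H3
  (rate `0`, bounded correlations), and kills `ConclC` through `sch.a_pos`. Honest label (as in the
  predecessor): the clause isolated is `∀ β, 0 < a β`; whether the two-sided BOUNDS of H1, or H2, or
  `Continuous a` itself are used is formally undecidable today (§1).
* §3 TIGHTNESS (proved; LANDED in `…/Negative/WeakCouplingConjunct.lean` — p123152 ACCEPTED, commit 583833091f03):
  `conclC_sans_nontriviality` — from `a > 0`, `a → 0` and H3 ALONE: a scheme in units `a` with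
  `β_k = β₂ + k → +∞` (so the NEW conjunct `HasWeakCouplingLimit` is free), vacuum OS data,
  `IsYangMillsFor` (renormalisations `c ≡ 0`), `HasLatticeMassGap r sch c₁`. All content of the crux
  is `IsNontrivial ∧ IsNonGaussian` for a `T` tied to the lattice by `IsYangMillsFor` (E1, E0′ for
  the curvature strings of all orders, femto → large-torus decoupling — predecessor §5
  `scheme_tori_eventually_not_femto` applies verbatim: H1/H2 are eventually vacuous on the scheme's
  own tori).
* §4 ANATOMY OF THE NEW CONJUNCT (proved; LANDED in `…/Negative/WeakCouplingConjunct.lean` — p123152):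
  (a) `tendsto_abs_beta_of_units` — for CONTINUOUS positive `a`, ANY scheme in units `a` has
  `|β_k| → ∞` (a positive continuous function is bounded below on compacts; `a_k → 0`);
  (b) `hasWeakCouplingLimit_of_units_of_eventually_le` — so `β_k → +∞` costs exactly an eventual
  LOWER bound on `β_k`, which every use of H3 (`β_k ≥ β₂`) supplies;
  (c) `exists_unitsScheme_not_weakCoupling` — but it is NOT implied by the units clause alone
  (`a β = (1 + β²)⁻¹`, `β_k = −(k+1)`): the conjunct is load-bearing only against schemes running to
  `β = −∞`, physically idle; (d) `exists_discontinuousUnits_scheme_bounded_beta` — WITHOUT continuity a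
  scheme in units `a` can sit at bounded `β_k ∈ (0,1]` while `a_k → 0` (so in 16110 the conjunct had
  teeth; in 16207 it only fixes the sign). Net: the re-type's new conjunct adds nothing a prover pays for.
* §5 THE CRUX IS A GERM PROPERTY OF `a` AT `+∞` (proved; `conclC_congr_above`,
  `hasWeakCouplingLimit_of_units_tailLift`, `conclC_of_concl_tailLift` LANDED as
  `…/Negative/GermAtInfinity.lean` — p123162 ACCEPTED, commit 8466374c6b87):
  `SpeciesScheme.shift` + `conclC_congr_above` — under `HasWeakCouplingLimit` the conclusion for `a`
  transfers to every `a'` agreeing with `a` on some `[βs, ∞)` (drop the first `K` steps of the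
  scheme; `IsYangMillsFor`, `HasLatticeMassGap`, `HasWeakCouplingLimit` are shift-stable). With the
  predecessor's `twoPoint_congr_above / skewness_congr_above / gapInUnits_congr_above` this gives
  `cruxC_pointwise_congr_above`: the crux instance at `(G, r, a)` follows from the instance at any
  positive `a'` with the same germ. Consequences: (i) `Continuous a` may be weakened to continuity on a
  tail `[βs, ∞)` at no cost (`cruxC_pointwise_of_continuousOn_tail`: modify `a` below `βs`);
  (ii) the global clause `∀ β, 0 < a β` is used only above the thresholds; (iii) POSITIVE by-product
  (prover-side, attached as evidence `Implication9367to16207.lean`, not mine to land): `crux9367_imp_cruxC :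
  OSLegsFromFemtoAndGap → OSLegsAtWeakCouplingC` — the planner's "both older items imply it" is TRUE
  and is pure glue PLUS one use of continuity (apply 9367 to `ã β = a (max β βs) + max (βs − β) 0`,
  which is `≥ a βs` below `βs`, so `ã(β_k) → 0` forces `β_k → +∞`; then shift back to units `a`).
  So 16207 ⟸ 9367 ⟸ (nothing known); the C re-type did not make the crux harder or easier to refute.
* §6 REPARAMETRISATION AUDIT FOR C (paper + the landed pin): the predecessor's fake-unit-map threat
  (§6/§8 there: step maps with incommensurable plateaux) is closed by continuity exactly as repair R1
  predicted — `twoPointPinned_of_continuous` / `stubPin_of_continuous` (Theorems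
  `LangevinControlUVOSLegsFromFemtoAndGapStubPinOfContinuous`) pin `a` to the scale where the
  dimensionless amplitude `n⁸Cov` takes a fixed value, through H1's single `Γ` and the IVT. The
  catalogued barrier `Literature.Barriers.QuantumFields.FixedCouplingUltralocality` (scaling limits at
  bounded lattice correlation length are ultralocal) therefore has no target INSIDE the hypotheses: it
  bites only a proof that would take the limit without using H1's lower bound (which is what ties
  `a` to `ξ`). Recorded, no lemma.
* §7 NATURAL STRENGTHENINGS (inherited): the ∀-scheme form of the conclusion is FALSE — predecessor
  `not_forall_scheme_strengthening` (Negative/ForallSchemeFalse, p73259) already quantifies over schemes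
  WITH `Tendsto sch.β atTop atTop`, so it refutes the ∀-scheme strengthening of `ConclC` verbatim
  (`not_forall_scheme_strengtheningC`). Renormalisations stay witness data.
* §8 NEAR-MISSES (sorried, this file only): `cruxC_false_without_continuity` (= ¬ 16110: blocked by
  §1, needs an H1 ∧ H2 ∧ H3 witness along a discontinuous map AND a no-go for its limits);
  `not_isNonGaussian_of_curv_unrenormalised` (with `c_curv ≡ 0` also `IsNonGaussian` should fail, but
  `IsNonGaussian` quantifies COMPLEX `f, g, h` with an arbitrary off-diagonal tensor witness, and
  splitting it into real off-diagonal tensors needs the jet factorisation "`jet(f⊗g⊗h) = 0 ⇒` one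
  factor's jet vanishes" — not in the tree; `IsNontrivial` already fails, so nothing is lost).

-- Targets: none (no line picked; payload.stuck_stubs = []).
-/

namespace Summit.QuantumFields.YangMills.Cruxes.OSLegsAtWeakCouplingC.Disproof

open Literature.MathematicalPhysics.QuantumFieldTheory Literature.MathematicalPhysics.QuantumLattice
open Literature.MathematicalPhysics.AQFT
open Filter MeasureTheory Topology
open Summit.QuantumFields.YangMills.Theses.LangevinControlUV (OSLegsAtWeakCouplingC
  OSLegsAtWeakCoupling OSLegsFromFemtoAndGap)
open Summit.QuantumFields.YangMills.Cruxes.OSLegsFromFemtoAndGap.Disproof (TwoPoint Skewness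
  GapInUnits Concl unitScheme su2Rep isCompactSimpleLieGroup_su2 not_concl_of_unitMap_zero
  skewness_of_unitMap_zero gapInUnits_of_unitMap_zero twoPoint_congr_above skewness_congr_above
  gapInUnits_congr_above)
open Summit.QuantumFields.YangMills.Theorems.OSLegsFromFemtoAndGap.Negative
  (hasLatticeMassGap_of_gapInUnits isYangMillsFor_vacuum_of_c_zero not_forall_scheme_strengthening)

noncomputable section

/-! ## §0 Anatomy: the new conclusion as a named predicate; the crux uncurried -/

section Anatomy

variable (G : Type) [Group G] [TopologicalSpace G] [IsTopologicalGroup G] [CompactSpace G]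
  [MeasurableSpace G] [BorelSpace G] (r : LatticeRep G) (a : ℝ → ℝ)

/-- The conclusion of the C-crux for `(G, r, a)` (verbatim body): the old `Concl` with the
weak-coupling conjunct `sch.HasWeakCouplingLimit` inserted. [folklore] -/
def ConclC : Prop :=
  ∃ (sch : SpeciesScheme (YMSpecies G)) (T : OSData (YMSpecies G) 4), (∀ k, sch.a k = a (sch.β k)) ∧ sch.HasWeakCouplingLimit ∧ IsYangMillsFor r sch T ∧ T.IsNontrivial r.curvature ∧ T.IsNonGaussian r.curvature ∧ ∃ Δ > 0, HasLatticeMassGap r sch Δ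

variable {G r a} in
/-- The new conclusion implies the old one (drop the conjunct). [folklore] -/
theorem conclC_imp_concl (h : ConclC G r a) : Concl G r a := by
  obtain ⟨sch, T, hu, -, hYM, hNT, hNG, hgap⟩ := h
  exact ⟨sch, T, hu, hYM, hNT, hNG, hgap⟩

end Anatomy

/-- §0. The crux, uncurried: `Continuous a → H1 → H2 → H3 → ConclC` for every compact simple `G`,
every `r`, every unit map `a` (definitional unfolding of the route decl). [folklore] -/
theorem cruxC_iff :
    OSLegsAtWeakCouplingC ↔
      ∀ (G : Type) [Group G] [TopologicalSpace G] [IsTopologicalGroup G] [CompactSpace G],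
        IsCompactSimpleLieGroup G →
          letI : MeasurableSpace G := borel G
          haveI : BorelSpace G := ⟨rfl⟩
          ∀ (r : LatticeRep G) (a : ℝ → ℝ), Continuous a →
            TwoPoint G r a → Skewness G r a → GapInUnits G r a → ConclC G r a :=
  Iff.rfl

/-- §0. `OSLegsAtWeakCoupling` (stmt-16110, no continuity hypothesis) implies the C-crux (one token). [folklore] -/
theorem cruxC_of_crux16110 (h : OSLegsAtWeakCoupling) : OSLegsAtWeakCouplingC :=
  fun G _ _ _ _ hG r a _ => h G hG r a

/-! ## §1 The wall (inherited, not softened by continuity) -/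

/-- The `∃`-core any refutation of the C-crux must produce: a compact simple Lie group, a faithful
unitary lattice representation and a CONTINUOUS unit map meeting H1 ∧ H2 ∧ H3 — whose H3 component
is the lattice mass gap at every coupling `β ≥ β₂` (Chatterjee arXiv:1803.01950, Problem 5.1; tree
conjecture `LatticeMassGapAllCouplings`). [cite: arXiv180301950, Problem 5.1] -/
def HypothesesWitnessC : Prop :=
  ∃ (G : Type) (_ : Group G) (_ : TopologicalSpace G) (_ : IsTopologicalGroup G) (_ : CompactSpace G),
    IsCompactSimpleLieGroup G ∧
      letI : MeasurableSpace G := borel G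
      haveI : BorelSpace G := ⟨rfl⟩
      ∃ (r : LatticeRep G) (a : ℝ → ℝ), Continuous a ∧ TwoPoint G r a ∧ Skewness G r a ∧ GapInUnits G r a

/-- **Disproof burden (C).** Any proof of `¬ OSLegsAtWeakCouplingC` yields a compact simple `G`,
`r` and a continuous `a` with H1 ∧ H2 ∧ H3 — in particular a PROOF of the volume-uniform lattice
mass gap in units `a` at every coupling `β ≥ β₂` for a genuine 4D non-abelian gauge theory. [folklore] -/
theorem hypothesesWitness_of_not_cruxC (h : ¬ OSLegsAtWeakCouplingC) : HypothesesWitnessC := by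
  by_contra hw
  apply h
  rw [cruxC_iff]
  intro G _ _ _ _ hG r a ha h1 h2 h3
  exact absurd ⟨G, _, _, _, _, hG, r, a, ha, h1, h2, h3⟩ hw

/-- Conversely: no hypotheses witness ⇒ the C-crux holds (vacuously). [folklore] -/
theorem cruxC_of_not_witness (hw : ¬ HypothesesWitnessC) : OSLegsAtWeakCouplingC := by
  rw [cruxC_iff]
  intro G _ _ _ _ hG r a ha h1 h2 h3
  exact absurd ⟨G, _, _, _, _, hG, r, a, ha, h1, h2, h3⟩ hw

/-! ## §2 Cheap load-bearing analysis: H1 (its positivity clause) — `a ≡ 0` is continuous -/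

section LoadBearing

variable (G : Type) [Group G] [TopologicalSpace G] [IsTopologicalGroup G] [CompactSpace G]
  [MeasurableSpace G] [BorelSpace G]

/-- With `a ≡ 0` the new conclusion is false (a scheme has positive spacings). [folklore] -/
theorem not_conclC_of_unitMap_zero (r : LatticeRep G) : ¬ ConclC G r (fun _ => 0) :=
  fun h => not_concl_of_unitMap_zero G r (conclC_imp_concl h)

/-- **H1 is load-bearing (cheaply), pointwise form, C-version.** For EVERY compact group `G` and
every `r`, the C-crux with the two-point package dropped fails at the CONTINUOUS unit map `a ≡ 0`
(predecessor §2 witnesses `skewness_of_unitMap_zero`, `gapInUnits_of_unitMap_zero` reused). [folklore] -/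
theorem cruxC_false_without_twoPoint_pointwise (r : LatticeRep G) :
    ¬ ∀ a : ℝ → ℝ, Continuous a → Skewness G r a → GapInUnits G r a → ConclC G r a := fun h =>
  not_conclC_of_unitMap_zero G r
    (h _ continuous_const (skewness_of_unitMap_zero G r) (gapInUnits_of_unitMap_zero G r))

end LoadBearing

/-- The C-crux with hypothesis H1 (`TwoPoint`) dropped. [folklore] -/
def WithoutTwoPointC : Prop :=
  ∀ (G : Type) [Group G] [TopologicalSpace G] [IsTopologicalGroup G] [CompactSpace G],
    IsCompactSimpleLieGroup G →
      letI : MeasurableSpace G := borel G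
      haveI : BorelSpace G := ⟨rfl⟩
      ∀ (r : LatticeRep G) (a : ℝ → ℝ), Continuous a → Skewness G r a → GapInUnits G r a → ConclC G r a

/-- **`OSLegsAtWeakCouplingC` is false without H1** (unconditional, via `SU(2)` fundamental and the
continuous map `a ≡ 0`): any proof of the crux must use H1 — at least its positivity clause.
LANDED with verbatim bodies as `Theorems/OSLegsAtWeakCouplingC/Negative/FalseWithoutTwoPoint.lean` (p123141). [folklore] -/
theorem cruxC_false_without_twoPoint : ¬ WithoutTwoPointC := by
  intro h
  letI : MeasurableSpace (Matrix.specialUnitaryGroup (Fin 2) ℂ) := borel _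
  haveI : BorelSpace (Matrix.specialUnitaryGroup (Fin 2) ℂ) := ⟨rfl⟩
  exact cruxC_false_without_twoPoint_pointwise _ su2Rep (h _ isCompactSimpleLieGroup_su2 su2Rep)

/-! ## §3 Tightness: everything but non-triviality is free — including the new conjunct -/

section Tightness

variable {G : Type} [Group G] [TopologicalSpace G] [IsTopologicalGroup G] [CompactSpace G]
  [MeasurableSpace G] [BorelSpace G]

/-- The predecessor's `unitScheme` (`β_k = β₂ + k`) is a weak-coupling scheme. [folklore] -/
theorem unitScheme_hasWeakCouplingLimit (ι : Type) (a : ℝ → ℝ) (ha : ∀ β, 0 < a β)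
    (hlim : Tendsto a atTop (𝓝 0)) (S₁ : ℝ → ℕ) (β₂ : ℝ) :
    (unitScheme ι a ha hlim S₁ β₂).HasWeakCouplingLimit :=
  tendsto_atTop_add_const_left _ _ tendsto_natCast_atTop_atTop

/-- **Tightness (C): the conclusion minus `IsNontrivial ∧ IsNonGaussian` — INCLUDING
`HasWeakCouplingLimit` — follows from `a > 0`, `a → 0` and H3 alone** (vacuum OS data, zero
renormalisations, `unitScheme` with `β_k = β₂ + k → +∞`). So the units clause, the weak-coupling
clause and the lattice-gap clause are free; all content is a NON-vacuum `T` tied to the lattice by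
`IsYangMillsFor`. LANDED in `Theorems/OSLegsAtWeakCouplingC/Negative/WeakCouplingConjunct.lean` (p123152). [folklore] -/
theorem conclC_sans_nontriviality (r : LatticeRep G) {a : ℝ → ℝ} (ha : ∀ β, 0 < a β)
    (hlim : Tendsto a atTop (𝓝 0)) (h3 : GapInUnits G r a) :
    ∃ (sch : SpeciesScheme (YMSpecies G)) (T : OSData (YMSpecies G) 4),
      (∀ k, sch.a k = a (sch.β k)) ∧ sch.HasWeakCouplingLimit ∧ IsYangMillsFor r sch T ∧
        ∃ Δ > 0, HasLatticeMassGap r sch Δ := by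
  obtain ⟨c₁, β₂, S₁, hc₁, hgap⟩ := h3
  refine ⟨unitScheme _ a ha hlim S₁ β₂, OSData.vacuum _ 4, fun k => rfl,
    unitScheme_hasWeakCouplingLimit _ a ha hlim S₁ β₂,
    isYangMillsFor_vacuum_of_c_zero r _ (fun _ _ => rfl), c₁, hc₁, ?_⟩
  refine hasLatticeMassGap_of_gapInUnits r hgap _ (fun k => rfl)
    (Eventually.of_forall fun k => ?_) (Eventually.of_forall fun k => le_max_left _ _)
  show β₂ ≤ β₂ + k
  exact le_add_of_nonneg_right (Nat.cast_nonneg k)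

/-- In H1 form: the two-point package supplies `a > 0`, `a → 0`, so H1 ∧ H3 give the C-conclusion
minus non-triviality (H2 unused, the BOUNDS of H1 unused, `Continuous a` unused). [folklore] -/
theorem conclC_sans_nontriviality' (r : LatticeRep G) {a : ℝ → ℝ} (h1 : TwoPoint G r a)
    (h3 : GapInUnits G r a) :
    ∃ (sch : SpeciesScheme (YMSpecies G)) (T : OSData (YMSpecies G) 4),
      (∀ k, sch.a k = a (sch.β k)) ∧ sch.HasWeakCouplingLimit ∧ IsYangMillsFor r sch T ∧
        ∃ Δ > 0, HasLatticeMassGap r sch Δ := by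
  obtain ⟨_, _, _, _, _, _, _, ha, hlim, _⟩ := h1
  exact conclC_sans_nontriviality r ha hlim h3

end Tightness

/-! ## §4 Anatomy of the new conjunct `HasWeakCouplingLimit` under `Continuous a` -/

section WeakCoupling

variable {ι : Type}

/-- **(a) Any scheme in CONTINUOUS positive units leaves every compact coupling window:
`|β_k| → ∞`.** (`a` continuous and positive is bounded below by a positive constant on `[-M, M]`,
while `a(β_k) = a_k → 0`.) [folklore] -/
theorem tendsto_abs_beta_of_units {a : ℝ → ℝ} (ha : Continuous a) (hpos : ∀ β, 0 < a β)
    (sch : SpeciesScheme ι) (hu : ∀ k, sch.a k = a (sch.β k)) :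
    Tendsto (fun k => |sch.β k|) atTop atTop := by
  rw [tendsto_atTop]
  intro M
  rcases lt_or_ge M 0 with hM | hM
  · exact Eventually.of_forall fun k => (hM.le.trans (abs_nonneg _))
  -- minimum of `a` on the compact window `[-M, M]`
  obtain ⟨x₀, hx₀, hmin⟩ := (isCompact_Icc : IsCompact (Set.Icc (-M) M)).exists_isMinOn
    ⟨0, by constructor <;> linarith⟩ ha.continuousOn
  have hε : 0 < a x₀ := hpos x₀
  have hev : ∀ᶠ k in atTop, sch.a k < a x₀ := sch.tendsto_a.eventually (gt_mem_nhds hε)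
  filter_upwards [hev] with k hk
  by_contra hlt
  push Not at hlt
  have hmem : sch.β k ∈ Set.Icc (-M) M := by
    constructor <;> [linarith [neg_abs_le (sch.β k)]; linarith [le_abs_self (sch.β k)]]
  have := hmin hmem
  rw [Set.mem_setOf_eq, ← hu k] at this
  linarith

/-- **(b) … so the weak-coupling conjunct costs exactly an eventual lower bound on `β_k`**
(which every use of H3, `β_k ≥ β₂`, supplies). [folklore] -/
theorem hasWeakCouplingLimit_of_units_of_eventually_le {a : ℝ → ℝ} (ha : Continuous a)
    (hpos : ∀ β, 0 < a β) (sch : SpeciesScheme ι) (hu : ∀ k, sch.a k = a (sch.β k)) {B : ℝ}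
    (hB : ∀ᶠ k in atTop, B ≤ sch.β k) : sch.HasWeakCouplingLimit := by
  unfold SpeciesScheme.HasWeakCouplingLimit
  rw [tendsto_atTop]
  intro M
  have h := (tendsto_atTop.1 (tendsto_abs_beta_of_units ha hpos sch hu)) (max M (|B| + 1))
  filter_upwards [h, hB] with k hk hkB
  have h1 : |B| + 1 ≤ |sch.β k| := le_of_max_le_right hk
  have h2 : M ≤ |sch.β k| := le_of_max_le_left hk
  -- `β_k ≥ B` excludes the negative branch of `|β_k| ≥ |B| + 1`
  have hnonneg : 0 ≤ sch.β k := by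
    by_contra hneg
    push Not at hneg
    rw [abs_of_neg hneg] at h1
    linarith [neg_abs_le B]
  rwa [abs_of_nonneg hnonneg] at h2

/-- The unit map of (c): `a β = (1 + β²)⁻¹` — continuous, positive, `→ 0` at `+∞` (and at `−∞`). [folklore] -/
def lorentzUnit (β : ℝ) : ℝ := (1 + β ^ 2)⁻¹

theorem continuous_lorentzUnit : Continuous lorentzUnit :=
  Continuous.inv₀ (by fun_prop) fun β => by positivity

theorem lorentzUnit_pos (β : ℝ) : 0 < lorentzUnit β := by
  unfold lorentzUnit; positivity

theorem tendsto_lorentzUnit : Tendsto lorentzUnit atTop (𝓝 0) := by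
  unfold lorentzUnit
  refine tendsto_inv_atTop_zero.comp ?_
  refine tendsto_atTop_add_const_left _ _ ?_
  exact (tendsto_pow_atTop two_ne_zero)

variable (ι) in
/-- The scheme of (c): `β_k = −(k+1)`, `a_k = (1 + (k+1)²)⁻¹ = lorentzUnit β_k`, `L_k = (k+1)³`,
zero renormalisations. [folklore] -/
def negBetaScheme : SpeciesScheme ι where
  a k := (1 + ((k : ℝ) + 1) ^ 2)⁻¹
  a_pos k := by positivity
  tendsto_a := by
    refine tendsto_inv_atTop_zero.comp (tendsto_atTop_add_const_left _ _ ?_)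
    exact (tendsto_pow_atTop two_ne_zero).comp
      (tendsto_natCast_atTop_atTop.atTop_add tendsto_const_nhds)
  β k := -((k : ℝ) + 1)
  L k := (k + 1) ^ 3
  tendsto_L := by
    have hle : ∀ k : ℕ, ((k : ℝ) + 1) / 2 ≤ (1 + ((k : ℝ) + 1) ^ 2)⁻¹ * (((k + 1) ^ 3 : ℕ) : ℝ) := by
      intro k
      have hk : (0 : ℝ) ≤ k := Nat.cast_nonneg k
      have hpos : (0 : ℝ) < 1 + ((k : ℝ) + 1) ^ 2 := by positivity
      have h3 : 0 ≤ ((k : ℝ) + 1) * (((k : ℝ) + 1) ^ 2 - 1) :=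
        mul_nonneg (by positivity) (by nlinarith)
      have key : ((k : ℝ) + 1) / 2 * (1 + ((k : ℝ) + 1) ^ 2) ≤ (((k + 1) ^ 3 : ℕ) : ℝ) := by
        push_cast
        nlinarith [h3]
      calc ((k : ℝ) + 1) / 2
          = ((k : ℝ) + 1) / 2 * (1 + ((k : ℝ) + 1) ^ 2) * (1 + ((k : ℝ) + 1) ^ 2)⁻¹ := by
            field_simp
        _ ≤ (((k + 1) ^ 3 : ℕ) : ℝ) * (1 + ((k : ℝ) + 1) ^ 2)⁻¹ :=
            mul_le_mul_of_nonneg_right key (inv_nonneg.2 hpos.le)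
        _ = _ := mul_comm _ _
    refine tendsto_atTop_mono hle ?_
    exact (tendsto_natCast_atTop_atTop.atTop_add tendsto_const_nhds).atTop_div_const
      (by norm_num : (0 : ℝ) < 2)
  c _ _ := 0
  m _ _ := 0

/-- The scheme of (c) is in units `lorentzUnit`. [folklore] -/
theorem negBetaScheme_units (k : ℕ) : (negBetaScheme ι).a k = lorentzUnit ((negBetaScheme ι).β k) := by
  show (1 + ((k : ℝ) + 1) ^ 2)⁻¹ = (1 + (-((k : ℝ) + 1)) ^ 2)⁻¹
  rw [neg_sq]

/-- The scheme of (c) runs to `β = −∞`: not a weak-coupling limit. [folklore] -/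
theorem not_hasWeakCouplingLimit_negBetaScheme : ¬ (negBetaScheme ι).HasWeakCouplingLimit :=
  SpeciesScheme.not_hasWeakCouplingLimit_of_le _ (B := 0) fun k => by
    show -((k : ℝ) + 1) ≤ 0
    linarith [(Nat.cast_nonneg k : (0 : ℝ) ≤ k)]

variable (ι) in
/-- **(c) The weak-coupling conjunct is NOT implied by the units clause**, even for a continuous,
positive unit map tending to `0` at `+∞`: `a β = (1 + β²)⁻¹` with the scheme `β_k = −(k+1)`. So in
`ConclC` the conjunct `sch.HasWeakCouplingLimit` is load-bearing exactly against schemes escaping to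
`β = −∞` — excluded by any eventual lower bound on `β_k` ((b) above). [folklore] -/
theorem exists_unitsScheme_not_weakCoupling :
    ∃ a : ℝ → ℝ, Continuous a ∧ (∀ β, 0 < a β) ∧ Tendsto a atTop (𝓝 0) ∧
      ∃ sch : SpeciesScheme ι, (∀ k, sch.a k = a (sch.β k)) ∧ ¬ sch.HasWeakCouplingLimit :=
  ⟨lorentzUnit, continuous_lorentzUnit, lorentzUnit_pos, tendsto_lorentzUnit, negBetaScheme ι,
    negBetaScheme_units, not_hasWeakCouplingLimit_negBetaScheme⟩

variable (ι) in
/-- **(d) Continuity is what makes (a) work.** WITHOUT `Continuous a` a scheme "in units `a`" can sit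
at bounded couplings `β_k ∈ [0, 1]` while `a_k → 0`: `a β = β` on `{(n+1)⁻¹}` and `(1 + β²)⁻¹`
elsewhere (positive, `→ 0` at `+∞`, discontinuous at `0`), scheme `β_k = a_k = (k+1)⁻¹`,
`L_k = (k+1)²`. So in the continuity-free item 16110 the conjunct `HasWeakCouplingLimit` excludes
bounded-`β` schemes that the units clause admits; in 16207 continuity already forces `|β_k| → ∞`
and the conjunct only fixes the sign. [folklore] -/
theorem exists_discontinuousUnits_scheme_bounded_beta :
    ∃ a : ℝ → ℝ, (∀ β, 0 < a β) ∧ Tendsto a atTop (𝓝 0) ∧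
      ∃ sch : SpeciesScheme ι, (∀ k, sch.a k = a (sch.β k)) ∧ (∀ k, 0 < sch.β k ∧ sch.β k ≤ 1) ∧
        ¬ sch.HasWeakCouplingLimit := by
  classical
  let a : ℝ → ℝ := fun β => if ∃ n : ℕ, β = ((n : ℝ) + 1)⁻¹ then β else (1 + β ^ 2)⁻¹
  have hpos : ∀ β, 0 < a β := by
    intro β
    simp only [a]
    split_ifs with h
    · obtain ⟨n, rfl⟩ := h
      positivity
    · positivity
  have hlim : Tendsto a atTop (𝓝 0) := by
    have h2 : Tendsto (fun β : ℝ => (1 + β ^ 2)⁻¹) atTop (𝓝 0) :=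
      tendsto_inv_atTop_zero.comp (tendsto_atTop_add_const_left _ _ (tendsto_pow_atTop two_ne_zero))
    refine h2.congr' ?_
    filter_upwards [eventually_gt_atTop (1 : ℝ)] with β hβ
    have hne : ¬ ∃ n : ℕ, β = ((n : ℝ) + 1)⁻¹ := by
      rintro ⟨n, rfl⟩
      have : ((n : ℝ) + 1)⁻¹ ≤ 1 := inv_le_one_of_one_le₀ (by linarith [(Nat.cast_nonneg n : (0:ℝ) ≤ n)])
      linarith
    simp only [a, if_neg hne]
  let sch : SpeciesScheme ι :=
    { a := fun k => ((k : ℝ) + 1)⁻¹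
      a_pos := fun k => by positivity
      tendsto_a := tendsto_inv_atTop_zero.comp
        (tendsto_natCast_atTop_atTop.atTop_add tendsto_const_nhds)
      β := fun k => ((k : ℝ) + 1)⁻¹
      L := fun k => (k + 1) ^ 2
      tendsto_L := by
        have h : (fun k : ℕ => ((k : ℝ) + 1)⁻¹ * (((k + 1) ^ 2 : ℕ) : ℝ)) = fun k : ℕ => (k : ℝ) + 1 := by
          funext k; push_cast; field_simp
        rw [h]
        exact tendsto_natCast_atTop_atTop.atTop_add tendsto_const_nhds
      c := fun _ _ => 0
      m := fun _ _ => 0 }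
  refine ⟨a, hpos, hlim, sch, fun k => ?_, fun k => ⟨by positivity, ?_⟩, ?_⟩
  · have hk : ∃ n : ℕ, ((k : ℝ) + 1)⁻¹ = ((n : ℝ) + 1)⁻¹ := ⟨k, rfl⟩
    show ((k : ℝ) + 1)⁻¹ = a (((k : ℝ) + 1)⁻¹)
    simp only [a, if_pos hk]
  · show ((k : ℝ) + 1)⁻¹ ≤ 1
    exact inv_le_one_of_one_le₀ (by linarith [(Nat.cast_nonneg k : (0:ℝ) ≤ k)])
  · exact SpeciesScheme.not_hasWeakCouplingLimit_of_le _ (B := 1) fun k =>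
      inv_le_one_of_one_le₀ (by linarith [(Nat.cast_nonneg k : (0:ℝ) ≤ k)])

end WeakCoupling

/-! ## §5 The conclusion — hence the crux instance — is a germ property of `a` at `+∞` -/

section Germ

variable {ι : Type}

/-- Dropping the first `K` steps of a scheme. [folklore] -/
def shiftScheme (sch : SpeciesScheme ι) (K : ℕ) : SpeciesScheme ι where
  a k := sch.a (k + K)
  a_pos _ := sch.a_pos _
  tendsto_a := sch.tendsto_a.comp (tendsto_add_atTop_nat K)
  β k := sch.β (k + K)
  L k := sch.L (k + K)
  tendsto_L := sch.tendsto_L.comp (tendsto_add_atTop_nat K)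
  c s k := sch.c s (k + K)
  m s k := sch.m s (k + K)

@[simp] theorem shiftScheme_a (sch : SpeciesScheme ι) (K k : ℕ) : (shiftScheme sch K).a k = sch.a (k + K) := rfl
@[simp] theorem shiftScheme_β (sch : SpeciesScheme ι) (K k : ℕ) : (shiftScheme sch K).β k = sch.β (k + K) := rfl
@[simp] theorem shiftScheme_L (sch : SpeciesScheme ι) (K k : ℕ) : (shiftScheme sch K).L k = sch.L (k + K) := rfl
@[simp] theorem shiftScheme_side (sch : SpeciesScheme ι) (K k : ℕ) :
    (shiftScheme sch K).side k = sch.side (k + K) := rfl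

/-- The weak-coupling clause is shift-stable. [folklore] -/
theorem hasWeakCouplingLimit_shift (sch : SpeciesScheme ι) (K : ℕ) (h : sch.HasWeakCouplingLimit) :
    (shiftScheme sch K).HasWeakCouplingLimit :=
  h.comp (tendsto_add_atTop_nat K)

variable {G : Type} [Group G] [TopologicalSpace G] [IsTopologicalGroup G] [CompactSpace G]
  [MeasurableSpace G] [BorelSpace G]

/-- Lattice Schwinger functions of the shifted scheme are the shifted lattice Schwinger functions. [folklore] -/
theorem latticeSchwinger_shift {N : ℕ} (ρ : G →* Matrix (Fin N) (Fin N) ℂ) (sch : SpeciesScheme ι)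
    (K : ℕ) (obs : ι → LGConfig 4 G → ℝ) (k n : ℕ) (σ : Fin n → ι)
    (f : Fin n → SchwartzMap (EuclideanSpace ℝ (Fin 4)) ℝ) :
    latticeSchwinger ρ (shiftScheme sch K) obs k n σ f = latticeSchwinger ρ sch obs (k + K) n σ f :=
  rfl

/-- `IsYangMillsFor` is shift-stable (a shifted convergent sequence converges to the same limit). [folklore] -/
theorem isYangMillsFor_shift (r : LatticeRep G) (sch : SpeciesScheme (YMSpecies G))
    (T : OSData (YMSpecies G) 4) (h : IsYangMillsFor r sch T) (K : ℕ) :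
    IsYangMillsFor r (shiftScheme sch K) T := by
  intro n hn σ f F hF hoff
  exact ((h n hn σ f F hF hoff).comp (tendsto_add_atTop_nat K)).congr'
    (Eventually.of_forall fun k => rfl)

/-- `HasLatticeMassGap` is shift-stable (an eventual clause). [folklore] -/
theorem hasLatticeMassGap_shift (r : LatticeRep G) (sch : SpeciesScheme ι) {Δ : ℝ}
    (h : HasLatticeMassGap r sch Δ) (K : ℕ) : HasLatticeMassGap r (shiftScheme sch K) Δ := by
  intro A B
  obtain ⟨C, hC⟩ := h A B
  exact ⟨C, (tendsto_add_atTop_nat K).eventually hC⟩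

/-- **`ConclC` is a germ property of the unit map** (this is where `HasWeakCouplingLimit` is USED):
if `a' = a` on some `[βs, ∞)` then `ConclC G r a → ConclC G r a'` — the weak-coupling scheme is
eventually above `βs`, drop its first `K` steps. No positivity or continuity of `a'` needed.
LANDED as `Theorems/OSLegsAtWeakCouplingC/Negative/GermAtInfinity.lean` (p123162). [folklore] -/
theorem conclC_congr_above (r : LatticeRep G) {a a' : ℝ → ℝ} (βs : ℝ)
    (heq : ∀ β, βs ≤ β → a' β = a β) (h : ConclC G r a) : ConclC G r a' := by
  obtain ⟨sch, T, hu, hw, hYM, hNT, hNG, Δ, hΔ, hgap⟩ := h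
  obtain ⟨K, hK⟩ := eventually_atTop.1 (hw.eventually_ge_atTop βs)
  refine ⟨shiftScheme sch K, T, fun k => ?_, hasWeakCouplingLimit_shift sch K hw,
    isYangMillsFor_shift r sch T hYM K, hNT, hNG, Δ, hΔ, hasLatticeMassGap_shift r sch hgap K⟩
  show sch.a (k + K) = a' (sch.β (k + K))
  rw [hu, heq _ (hK _ (Nat.le_add_left K k))]

/-- **The crux instance at `(G, r, a)` follows from the instance at any positive `a'` with the same
germ at `+∞`** (hypotheses transported forward by the predecessor's `*_congr_above`, the conclusion
back by `conclC_congr_above`). [folklore] -/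
theorem cruxC_pointwise_congr_above (r : LatticeRep G) {a a' : ℝ → ℝ} (βs : ℝ)
    (hpos' : ∀ β, 0 < a' β) (heq : ∀ β, βs ≤ β → a' β = a β)
    (h : TwoPoint G r a' → Skewness G r a' → GapInUnits G r a' → ConclC G r a') :
    TwoPoint G r a → Skewness G r a → GapInUnits G r a → ConclC G r a := fun h1 h2 h3 =>
  conclC_congr_above r βs (fun β hβ => (heq β hβ).symm)
    (h (twoPoint_congr_above r βs hpos' heq h1) (skewness_congr_above r βs heq h2)
      (gapInUnits_congr_above r βs heq h3))

/-- **Consequence (i): `Continuous a` may be weakened to continuity on a tail at no cost.** If the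
C-crux holds pointwise at `(G, r)` for every CONTINUOUS unit map, it holds for every unit map that is
merely continuous on some `[βs, ∞)` (replace `a` by `β ↦ a (max β βs)` below `βs`). [folklore] -/
theorem cruxC_pointwise_of_continuousOn_tail (r : LatticeRep G) {a : ℝ → ℝ} (βs : ℝ)
    (ha : ContinuousOn a (Set.Ici βs))
    (hall : ∀ a' : ℝ → ℝ, Continuous a' →
      TwoPoint G r a' → Skewness G r a' → GapInUnits G r a' → ConclC G r a') :
    TwoPoint G r a → Skewness G r a → GapInUnits G r a → ConclC G r a := by
  intro h1 h2 h3
  have h1' := h1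
  obtain ⟨-, -, -, -, -, -, -, hpos, -, -⟩ := h1'
  have ha' : Continuous fun β => a (max β βs) :=
    ha.comp_continuous (continuous_id.max continuous_const) fun β => Set.mem_Ici.2 (le_max_right _ _)
  have heq : ∀ β, βs ≤ β → (fun β => a (max β βs)) β = a β := fun β hβ => by
    simp [max_eq_left hβ]
  exact cruxC_pointwise_congr_above r βs (fun β => hpos _) heq (hall _ ha') h1 h2 h3

/-! ### §5b Positive by-product: `OSLegsFromFemtoAndGap → OSLegsAtWeakCouplingC` (9367 ⇒ 16207) -/

/-- The tail lift of a unit map: `ã β = a (max β βs) + max (βs − β) 0` — equal to `a` on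
`[βs, ∞)`, at least `a βs` below `βs`, continuous if `a` is, positive if `a` is. [folklore] -/
def tailLift (a : ℝ → ℝ) (βs : ℝ) (β : ℝ) : ℝ := a (max β βs) + max (βs - β) 0

theorem continuous_tailLift {a : ℝ → ℝ} (ha : Continuous a) (βs : ℝ) : Continuous (tailLift a βs) :=
  (ha.comp (continuous_id.max continuous_const)).add
    ((continuous_const.sub continuous_id).max continuous_const)

theorem tailLift_pos {a : ℝ → ℝ} (hpos : ∀ β, 0 < a β) (βs β : ℝ) : 0 < tailLift a βs β :=
  add_pos_of_pos_of_nonneg (hpos _) (le_max_right _ _)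

theorem tailLift_eq_of_le {a : ℝ → ℝ} (βs : ℝ) {β : ℝ} (h : βs ≤ β) : tailLift a βs β = a β := by
  unfold tailLift
  rw [max_eq_left h, max_eq_right (by linarith), add_zero]

theorem le_tailLift_of_le (a : ℝ → ℝ) (βs : ℝ) {β : ℝ} (h : β ≤ βs) : a βs ≤ tailLift a βs β := by
  unfold tailLift
  rw [max_eq_right h]
  exact le_add_of_nonneg_right (le_max_right _ _)

/-- A scheme in units `tailLift a βs` is eventually above `βs` (below `βs` the lift is `≥ a βs > 0`,
while `a_k → 0`). [folklore] -/
theorem eventually_le_beta_of_units_tailLift {a : ℝ → ℝ} (hpos : ∀ β, 0 < a β) (βs : ℝ)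
    (sch : SpeciesScheme ι) (hu : ∀ k, sch.a k = tailLift a βs (sch.β k)) :
    ∀ᶠ k in atTop, βs ≤ sch.β k := by
  have hev : ∀ᶠ k in atTop, sch.a k < a βs := sch.tendsto_a.eventually (gt_mem_nhds (hpos βs))
  filter_upwards [hev] with k hk
  by_contra hlt
  push Not at hlt
  have := le_tailLift_of_le a βs hlt.le
  rw [← hu k] at this
  linarith

/-- … hence (continuity!) it is a weak-coupling scheme. [folklore] -/
theorem hasWeakCouplingLimit_of_units_tailLift {a : ℝ → ℝ} (ha : Continuous a) (hpos : ∀ β, 0 < a β)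
    (βs : ℝ) (sch : SpeciesScheme ι) (hu : ∀ k, sch.a k = tailLift a βs (sch.β k)) :
    sch.HasWeakCouplingLimit :=
  hasWeakCouplingLimit_of_units_of_eventually_le (continuous_tailLift ha βs) (tailLift_pos hpos βs)
    sch hu (eventually_le_beta_of_units_tailLift hpos βs sch hu)

/-- The OLD conclusion along the tail lift gives the NEW conclusion along `a`. [folklore] -/
theorem conclC_of_concl_tailLift (r : LatticeRep G) {a : ℝ → ℝ} (ha : Continuous a)
    (hpos : ∀ β, 0 < a β) (βs : ℝ) (h : Concl G r (tailLift a βs)) : ConclC G r a := by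
  obtain ⟨sch, T, hu, hYM, hNT, hNG, hgap⟩ := h
  exact conclC_congr_above r βs (fun β hβ => (tailLift_eq_of_le βs hβ).symm)
    ⟨sch, T, hu, hasWeakCouplingLimit_of_units_tailLift ha hpos βs sch hu, hYM, hNT, hNG, hgap⟩

/-- **9367 ⇒ 16207, pointwise in `(G, r)`.** If the OLD crux holds at `(G, r)` for every unit map,
the C-crux holds at `(G, r)` for every continuous unit map: transport H1–H3 to the tail lift
(threshold `0`, say), apply the old crux there, come back by `conclC_of_concl_tailLift`. [folklore] -/
theorem cruxC_pointwise_of_crux9367_pointwise (r : LatticeRep G) {a : ℝ → ℝ} (ha : Continuous a)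
    (h9367 : ∀ a' : ℝ → ℝ, TwoPoint G r a' → Skewness G r a' → GapInUnits G r a' → Concl G r a') :
    TwoPoint G r a → Skewness G r a → GapInUnits G r a → ConclC G r a := by
  intro h1 h2 h3
  have h1' := h1
  obtain ⟨-, -, -, -, -, -, -, hpos, -, -⟩ := h1'
  have heq : ∀ β, (0 : ℝ) ≤ β → tailLift a 0 β = a β := fun β hβ => tailLift_eq_of_le 0 hβ
  exact conclC_of_concl_tailLift r ha hpos 0
    (h9367 _ (twoPoint_congr_above r 0 (tailLift_pos hpos 0) heq h1)
      (skewness_congr_above r 0 heq h2) (gapInUnits_congr_above r 0 heq h3))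

/-- **`OSLegsFromFemtoAndGap → OSLegsAtWeakCouplingC`** (the planner's "both older items imply it",
now kernel-checked: glue plus ONE use of `Continuous a`, inside
`hasWeakCouplingLimit_of_units_tailLift`). Positive statement — recorded here and attached as evidence
for a prover; not a Negative-lane lemma. [folklore] -/
theorem crux9367_imp_cruxC (h : OSLegsFromFemtoAndGap) : OSLegsAtWeakCouplingC := by
  rw [cruxC_iff]
  intro G _ _ _ _ hG
  letI : MeasurableSpace G := borel G
  haveI : BorelSpace G := ⟨rfl⟩
  intro r a ha
  exact cruxC_pointwise_of_crux9367_pointwise r ha fun a' => h G hG r a'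

end Germ

/-! ## §7 Natural strengthening (inherited): the ∀-scheme form of `ConclC` is false -/

section ForallScheme

variable {G : Type} [Group G] [TopologicalSpace G] [IsTopologicalGroup G] [CompactSpace G]
  [MeasurableSpace G] [BorelSpace G]

/-- The predecessor's `not_forall_scheme_strengthening` (Negative/ForallSchemeFalse, p73259) already
quantifies over WEAK-COUPLING schemes, so it refutes the ∀-scheme strengthening of `ConclC` verbatim:
for every `G, r`, every `a > 0` with `a → 0`, every `S₁, β₂`, NOT every scheme in units `a` with
`HasWeakCouplingLimit` and `L_k ≥ S₁(β_k)` carries non-trivial Yang–Mills OS data. [folklore] -/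
theorem not_forall_scheme_strengtheningC (r : LatticeRep G) {a : ℝ → ℝ} (ha : ∀ β, 0 < a β)
    (hlim : Tendsto a atTop (𝓝 0)) (S₁ : ℝ → ℕ) (β₂ : ℝ) :
    ¬ ∀ sch : SpeciesScheme (YMSpecies G), (∀ k, sch.a k = a (sch.β k)) →
        sch.HasWeakCouplingLimit → (∀ k, S₁ (sch.β k) ≤ sch.L k) →
          ∃ T : OSData (YMSpecies G) 4, IsYangMillsFor r sch T ∧ T.IsNontrivial r.curvature :=
  not_forall_scheme_strengthening r ha hlim S₁ β₂

end ForallScheme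

/-! ## §8 Near-misses (the ONLY sorries of this file; obstruction in each docstring) -/

section NearMiss

variable {G : Type} [Group G] [TopologicalSpace G] [IsTopologicalGroup G] [CompactSpace G]
  [MeasurableSpace G] [BorelSpace G]

/-- NEAR-MISS (true, not closed): with the curvature unrenormalised (`c_curv ≡ 0`) along a scheme tied
to `T` by `IsYangMillsFor`, `T` should also fail `IsNonGaussian` in the curvature (all curvature
strings vanish on real off-diagonal tensors, predecessor `schwinger_eq_zero_of_c_string_zero`).
OBSTRUCTION: `IsNonGaussian` quantifies COMPLEX `f, g, h` and an ARBITRARY off-diagonal tensor witness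
`Ffgh`; reducing `𝔖₃(Ffgh)` to real tensors needs (1) a Schwartz `tensor₃` constructor (only
`tensor₁/tensor₂` exist, `HypercubicLimit.Negative.NonTrivialityBridge`) and (2) the jet factorisation
"`f ⊗ g ⊗ h` flat at a coincident point ⇒ one factor is flat there" to see that the eight real
tensors are again off-diagonal. Tried: linearity split `f = Re f + i Im f` (fine for the `𝔖₁` terms,
which vanish: `isOffDiagonal_fin_one`), stuck at (2). Harmless: `IsNontrivial` already fails
(`not_isNontrivial_of_curv_unrenormalised`), which is what §7 uses. [folklore] -/
theorem not_isNonGaussian_of_curv_unrenormalised (r : LatticeRep G)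
    (sch : SpeciesScheme (YMSpecies G)) (hc : ∀ k, sch.c r.curvature k = 0)
    (T : OSData (YMSpecies G) 4) (hYM : IsYangMillsFor r sch T) :
    ¬ T.IsNonGaussian r.curvature := by
  sorry

/- NEAR-MISS (conjectural, prose only): `¬ OSLegsAtWeakCoupling` (stmt-16110 = this crux without
`Continuous a`), i.e. "continuity is load-bearing". The predecessor's §6/§8 fake-unit-map analysis
makes it plausible (step maps with pairwise incommensurable short plateaux could meet H1–H3 while every
limit along them is ultralocal), but a kernel-checked proof needs BOTH an H1 ∧ H2 ∧ H3 witness along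
such a map for a genuine `G` (§1 wall) AND a no-go for non-trivial OS limits along it (a mixing CLT
for Wilson's measure) — two open theorems. Not stated as a sorried theorem because its truth value is
itself open. -/

end NearMiss

end

end Summit.QuantumFields.YangMills.Cruxes.OSLegsAtWeakCouplingC.Disproof
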